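import Literature.Computability.AlgebraicComplexity.PerStabilizerMarcusMayProofs
import HarnessLib

/-!
# Marcus–May 1962 (the stabilizer of `perm_n`) over every infinite field of characteristic `≠ 2`

Topic `Literature/Computability/AlgebraicComplexity`; THEOREMS ONLY (no definition, no named fact;
D-0026), companion of `PerStabilizerMarcusMay.lean` / `PerStabilizerMarcusMayProofs.lean`.

M. Marcus, F. C. May, *The permanent function*, Canad. J. Math. 14 (1962) 177–189, §2 Theorem
with remark (2.7), p. 179 (case `r = m = n > 2`, `S_n = 1`), over a field "with at least `n`
elements" and characteristic `≠ 2`: "the only linear operations which hold the permanent fixed,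
that is, `per(T(X)) = per(X)` for all `X ∈ M_{n,n}`, must be obtainable (to within taking the
transpose) by pre- and post-multiplication of `X` by diagonal matrices whose product has
permanent 1 together with pre- and post-multiplication of `X` by permutation matrices"
[cite: MarcusMay1962, §2 Theorem (2.3)–(2.4) and remark (2.7), p. 179]; re-proved by P. Botta,
*Linear transformations that preserve the permanent*, Proc. AMS 18 (1967) 566–569
[cite: Botta1967, §2, Theorem].

The tree types the theorem as the named fact `marcusMay1962_perPreserver_sandwich` OVER `ℂ` and
proves it (`marcusMay1962_perPreserver_sandwich_holds`); the parent file records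
`-- TODO(general form): any field with ≥ n elements and characteristic ≠ 2`. The proofs file
already carries Botta's argument over ANY INFINITE FIELD with `2 ≠ 0`
(`MarcusMay.exists_sandwich_of_permanent_eq`); only the final discharge was specialised to `ℂ`.
This file states the consequence at that generality, in the binders of the named fact with `ℂ`
replaced by a field `F`, `[Infinite F]`, `(2 : F) ≠ 0`:

* `marcusMay1962_perPreserver_sandwich_of_infinite` — for `n ≥ 3` and a square matrix `M` over
  `Fin n × Fin n` with `linSubst M per_n = per_n`, the action `X ↦ mat(Mᵀ · vec X)` on `M_n(F)` is
  a monomial sandwich `X ↦ D P_π X P_ρ L` or `X ↦ D P_π Xᵀ P_ρ L` with `(∏ d)(∏ l) = 1`;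
* `marcusMay1962_perPreserver_sandwich_of_infinite_of_mem_linStabilizer` — the same for every
  `γ ∈ linStabilizer (perPoly (Fin n) F)` (the description of `Stab(perm_n) ≤ GL_{n²}(F)` quoted in
  GCT II Thm. 2.3);
* `marcusMay1962_perPreserver_sandwich_of_charZero` — the characteristic-`0` corollary (every field
  of characteristic `0` is infinite with `2 ≠ 0`).

The remaining printed generality (FINITE fields with at least `n` elements) is NOT covered:
Botta's Lemma 2 in the tree (`MarcusMay.subperm_eq_zero_of_affine`) reads off a coefficient of a
polynomial in `z` and uses that `F` is infinite. `-- TODO(general form): finite fields with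
≥ n elements and characteristic ≠ 2 (Marcus–May, loc. cit.).`

Honest framing: classical linear algebra (1962/1967); a generality bookkeeping step for the
stabilizer descriptions used by GCT I/II typings (cell `val-lit`, row MS2001-A, seat t01).
Nothing here bears on VP versus VNP, which is NOT proved.
-/

noncomputable section

open MvPolynomial Matrix

namespace Literature.Computability.AlgebraicComplexity

namespace MarcusMayAllFields

/-- Evaluating a linear substitution: `(linSubst M f)(x) = f(Mᵀ x)` (copy, over any commutative ring,
of the private helper of `PerStabilizerMarcusMayProofs.lean`). [folklore] -/
private theorem eval_linSubst {σ R : Type*} [Fintype σ] [CommRing R] (M : Matrix σ σ R) (x : σ → R)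
    (f : MvPolynomial σ R) : eval x (linSubst σ R M f) = eval (Mᵀ *ᵥ x) f := by
  induction f using MvPolynomial.induction_on with
  | C a => rw [linSubst_C, eval_C, eval_C]
  | add p q hp hq => rw [map_add, map_add, map_add, hp, hq]
  | mul_X p i hp =>
    rw [map_mul, map_mul, map_mul, hp, linSubst_X, eval_X]
    congr 1
    simp [Matrix.mulVec, dotProduct, smul_eval]

end MarcusMayAllFields

open MarcusMayAllFields

/-- **Marcus–May 1962, §2 Theorem (stabilizer of `perm_n`, `n ≥ 3`) over every infinite field of
characteristic `≠ 2`** — the statement of the tree's named fact `marcusMay1962_perPreserver_sandwich`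
with `ℂ` replaced by a field `F`, `F` infinite, `(2 : F) ≠ 0`: if the linear substitution by a
square matrix `M` over `Fin n × Fin n` fixes the generic permanent, then `X ↦ mat(Mᵀ · vec X)` is
`X ↦ D P_π X P_ρ L` or `X ↦ D P_π Xᵀ P_ρ L` for permutations `π, ρ` and diagonal vectors `d, l` with
`(∏ d)(∏ l) = 1`. PROVED: evaluate the polynomial identity to get a linear permanent preserver of
`M_n(F)` and apply Botta's argument as formalised in the tree
(`MarcusMay.exists_sandwich_of_permanent_eq`, any infinite field with `2 ≠ 0`). The print's finite
fields with `≥ n` elements are not covered (see the module docstring).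
[cite: MarcusMay1962, §2 Theorem (2.3)–(2.4) and remark (2.7), p. 179]
[cite: Botta1967, §2, Theorem] -/
theorem marcusMay1962_perPreserver_sandwich_of_infinite (F : Type*) [Field F] [Infinite F]
    (h2 : (2 : F) ≠ 0) {n : ℕ} (hn : 3 ≤ n) (M : Matrix (Fin n × Fin n) (Fin n × Fin n) F)
    (hM : linSubst (Fin n × Fin n) F M (perPoly (Fin n) F) = perPoly (Fin n) F) :
    ∃ (π ρ : Equiv.Perm (Fin n)) (d l : Fin n → F), (∏ i, d i) * (∏ i, l i) = 1 ∧
      ((∀ x : Fin n × Fin n → F,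
          (Matrix.of fun a b => (Mᵀ *ᵥ x) (a, b)) =
            diagonal d * π.permMatrix F * (Matrix.of fun a b => x (a, b)) * ρ.permMatrix F *
              diagonal l) ∨
       (∀ x : Fin n × Fin n → F,
          (Matrix.of fun a b => (Mᵀ *ᵥ x) (a, b)) =
            diagonal d * π.permMatrix F * (Matrix.of fun a b => x (a, b))ᵀ * ρ.permMatrix F *
              diagonal l)) := by
  -- the linear map `T_M : X ↦ mat(Mᵀ · vec X)` of `M_n(F)`
  let T : Matrix (Fin n) (Fin n) F →ₗ[F] Matrix (Fin n) (Fin n) F :=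
    { toFun := fun X => Matrix.of fun a b => (Mᵀ *ᵥ fun p => X p.1 p.2) (a, b)
      map_add' := by
        intro X Y
        ext a b
        simp only [Matrix.add_apply, Matrix.of_apply]
        rw [← Pi.add_apply (Mᵀ *ᵥ _) (Mᵀ *ᵥ _), ← Matrix.mulVec_add]
        rfl
      map_smul' := by
        intro c X
        ext a b
        simp only [Matrix.smul_apply, Matrix.of_apply, RingHom.id_apply, Matrix.mulVec,
          dotProduct, smul_eq_mul, Finset.mul_sum]
        exact Finset.sum_congr rfl fun p _ => by ring }
  have hTx : ∀ x : Fin n × Fin n → F, T (Matrix.of fun a b => x (a, b)) =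
      Matrix.of fun a b => (Mᵀ *ᵥ x) (a, b) := by
    intro x
    have hx : (fun p : Fin n × Fin n => (Matrix.of fun a b => x (a, b)) p.1 p.2) = x := by
      funext p
      simp
    simp only [T, LinearMap.coe_mk, AddHom.coe_mk]
    rw [hx]
  -- `T_M` preserves the permanent of every matrix
  have hT : ∀ X, (T X).permanent = X.permanent := by
    intro X
    have h := congr_arg (MvPolynomial.eval fun p : Fin n × Fin n => X p.1 p.2) hM
    have hX : (Matrix.of fun i j => (fun p : Fin n × Fin n => X p.1 p.2) (i, j)) = X := by
      ext i j
      simp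
    rw [eval_linSubst, eval_perPoly, eval_perPoly, hX] at h
    exact h
  obtain ⟨π, ρ, d, l, hdl, h⟩ := MarcusMay.exists_sandwich_of_permanent_eq (F := F) h2
    (by rw [Fintype.card_fin]; exact hn) T hT
  refine ⟨π, ρ, d, l, hdl, ?_⟩
  rcases h with h | h
  · exact Or.inl fun x => by rw [← hTx, h]
  · exact Or.inr fun x => by rw [← hTx, h]

/-- **The stabilizer of `perm_n` in `GL_{n²}(F)`, `n ≥ 3`, `F` infinite of characteristic `≠ 2`**
(the description GCT II Thm. 2.3 quotes: "generated by linear transformations of the form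
`X → λ X μ^{-1}` … where `λ` and `μ` are either diagonal or permutation matrices", with Marcus–May's
transpose): every `γ ∈ linStabilizer (perPoly (Fin n) F)` acts on matrices as a monomial sandwich
`X ↦ D P_π X^{(T)} P_ρ L` with `(∏ d)(∏ l) = 1` — the field-general form of the tree's
`marcusMay1962_perPreserver_sandwich.of_mem_linStabilizer`.
[cite: MarcusMay1962, §2 Theorem and remark (2.7), p. 179]
[cite: MulmuleySohoniGCT2SIAM2008, Thm. 2.3 (arXiv cs/0612134 Thm. 3.3)] -/
theorem marcusMay1962_perPreserver_sandwich_of_infinite_of_mem_linStabilizer (F : Type*) [Field F]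
    [Infinite F] (h2 : (2 : F) ≠ 0) {n : ℕ} (hn : 3 ≤ n) {γ : GL (Fin n × Fin n) F}
    (hγ : γ ∈ linStabilizer (perPoly (Fin n) F)) :
    ∃ (π ρ : Equiv.Perm (Fin n)) (d l : Fin n → F), (∏ i, d i) * (∏ i, l i) = 1 ∧
      ((∀ x : Fin n × Fin n → F,
          (Matrix.of fun a b => ((γ : Matrix (Fin n × Fin n) (Fin n × Fin n) F)ᵀ *ᵥ x) (a, b)) =
            diagonal d * π.permMatrix F * (Matrix.of fun a b => x (a, b)) * ρ.permMatrix F *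
              diagonal l) ∨
       (∀ x : Fin n × Fin n → F,
          (Matrix.of fun a b => ((γ : Matrix (Fin n × Fin n) (Fin n × Fin n) F)ᵀ *ᵥ x) (a, b)) =
            diagonal d * π.permMatrix F * (Matrix.of fun a b => x (a, b))ᵀ * ρ.permMatrix F *
              diagonal l)) := by
  have hfix : linSubst (Fin n × Fin n) F (γ : Matrix (Fin n × Fin n) (Fin n × Fin n) F)
      (perPoly (Fin n) F) = perPoly (Fin n) F := by
    simpa only [mem_linStabilizer, linSubstRep_apply] using hγ
  exact marcusMay1962_perPreserver_sandwich_of_infinite F h2 hn _ hfix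

/-- **Marcus–May 1962 over every field of characteristic `0`** (such a field is infinite — `ℕ ↪ F` — with
`2 ≠ 0`): the stabilizer of `perm_n`, `n ≥ 3`, in `GL_{n²}(F)` consists of monomial sandwiches,
transposed or not. [cite: MarcusMay1962, §2 Theorem and remark (2.7), p. 179]
[cite: Botta1967, §2, Theorem] -/
theorem marcusMay1962_perPreserver_sandwich_of_charZero (F : Type*) [Field F] [CharZero F] {n : ℕ}
    (hn : 3 ≤ n) {γ : GL (Fin n × Fin n) F} (hγ : γ ∈ linStabilizer (perPoly (Fin n) F)) :
    ∃ (π ρ : Equiv.Perm (Fin n)) (d l : Fin n → F), (∏ i, d i) * (∏ i, l i) = 1 ∧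
      ((∀ x : Fin n × Fin n → F,
          (Matrix.of fun a b => ((γ : Matrix (Fin n × Fin n) (Fin n × Fin n) F)ᵀ *ᵥ x) (a, b)) =
            diagonal d * π.permMatrix F * (Matrix.of fun a b => x (a, b)) * ρ.permMatrix F *
              diagonal l) ∨
       (∀ x : Fin n × Fin n → F,
          (Matrix.of fun a b => ((γ : Matrix (Fin n × Fin n) (Fin n × Fin n) F)ᵀ *ᵥ x) (a, b)) =
            diagonal d * π.permMatrix F * (Matrix.of fun a b => x (a, b))ᵀ * ρ.permMatrix F *
              diagonal l)) := by
  haveI : Infinite F := Infinite.of_injective _ Nat.cast_injective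
  exact marcusMay1962_perPreserver_sandwich_of_infinite_of_mem_linStabilizer F two_ne_zero hn hγ

end Literature.Computability.AlgebraicComplexity

end
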